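import Summits.ABC.IUTFork.Joshi.LogVolumesHulls
import Literature.IUT.LogVolume.LocalFieldVolume

/-!
# Joshi's §9.10.2 volume signature at ANY nonarchimedean local field, and the D-05 normalisation identity
# `LogVol_E(h𝒪_E) = [E : ℚ_p] · μ^log_{Prop 1.4}(h𝒪_E)` (object level)

K. Joshi, *Construction of Arithmetic Teichmüller Spaces III* (arXiv:2401.13508 **v4**, unrefereed; bib
`Joshi2024ATS3`), §9.10.2 p.122 l.32 – p.123 l.38, §9.10.5 p.125 l.2–19. Cell abc-iut, block E (rung LADDER-ABC:A2.E), seat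
E-t23 (slot T-23; OBJECTS O-045, dictionary row D-05 «Vol_Joshi ↔ our log-volume»).
(1) `localFieldVolumeDatum`: for a local field `K` of the tree's norm class (`NontriviallyNormedField`,
`IsUltrametricDist`, `ProperSpace`; applies to every `L′_w`), Joshi's `Vol_K` := Mochizuki's `μ_k` of [AbsTopIII] Prop. 5.7
(i) (`Literature.IUT.LogVolume.localVolume K`), `𝒪_K` := the closed unit ball, and `|−|_K` := the MODULE `‖−‖^d`,
`d = [K : ℚ_p]` — the ONLY reading of `|−|_E` under which Joshi's field «Vol(λ𝒪_E) = |λ|_E» (Lem. 9.10.2.2 (2), p.123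
l.29–30; «clear from the definition of Vol_E») holds; all four property fields PROVED from the campaign-S Literature
layer, under the one classical relation `‖ϖ‖^d = q⁻¹` between a norm uniformizer, the degree and the residue
cardinality (hypothesis `hmod`; supplied by the MLF files from `‖p‖ = ‖ϖ‖^e`, `q = p^f`, `d = ef`).
(2) **D-05 at the level of ONE FACTOR, PROVED** (`logVol_ball_eq_degree_mul_normalized`): Joshi's `LogVol_K(α + h𝒪_K) =
d · log ‖h‖ = d · μ^log(h𝒪_K)`, where `μ^log = Literature.IUT.LogVolume.normalizedLocalLogVolume K d` is Mochizuki's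
DEGREE-normalised log-volume of [IUTchIV] Prop. 1.4 (i) («normalized [by dividing by the degree]»). Combined with
`gammaP_eq_packetWeightRaw` (p428811: Joshi's `γ = 1/[K : L_{mod,v}]`), Joshi's Γ_p-weighted factor term is `γ·d·log‖h‖ =
[L_{mod,v} : ℚ_p] · log ‖h‖` (`gammaP_mul_degree`, tower law as hypothesis) — numbers for E-ref's grading of «coincides
with [IUTchIII] Rmk 3.1.1» (p.125 l.13–15); no verdict here. `padicVolumeDatum` (p430954) is the case `K = ℚ_p`, `d = 1`.
FRAMING: standard local-field measure theory (Weil *BNT* I §2; [AbsTopIII] Prop. 5.7 (i)); nothing of Joshi's is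
asserted; no side taken on [IUTchIII] Cor. 3.12 or on any author.
-/

noncomputable section

namespace Summit.ABC.IUTFork.Joshi.LogVol

open MeasureTheory Metric Literature.IUT.LogVolume Literature.NumberTheory.GaloisRepresentations.Ultrametric
open scoped NNReal ENNReal Pointwise

variable (K : Type*) [NontriviallyNormedField K] [IsUltrametricDist K]

/-! ## The integral structure and the module as an absolute value -/

/-- `𝒪_K = {‖x‖ ≤ 1}` as a subring (ultrametric inequality). [folklore] -/
def unitSubring : Subring K where
  carrier := {x | ‖x‖ ≤ 1}
  mul_mem' ha hb := (norm_mul _ _).trans_le (mul_le_one₀ ha (norm_nonneg _) hb)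
  one_mem' := by simp
  add_mem' ha hb := (IsUltrametricDist.norm_add_le_max _ _).trans (max_le ha hb)
  zero_mem' := by simp
  neg_mem' ha := by simpa using ha

/-- The carrier of `unitSubring` is the closed unit ball. [folklore] -/
theorem coe_unitSubring : ((unitSubring K : Subring K) : Set K) = closedBall 0 1 := by
  ext x; simp [unitSubring]

/-- The MODULE `|x|_K := ‖x‖^d` (`d = [K : ℚ_p]`; Weil's `mod_K`) as an absolute value: multiplicative, and ultrametric
because `‖−‖` is. [folklore] -/
def modAbs (d : ℕ) (hd : d ≠ 0) : AbsoluteValue K ℝ where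
  toFun x := ‖x‖ ^ d
  map_mul' x y := by simp [norm_mul, mul_pow]
  nonneg' x := pow_nonneg (norm_nonneg x) d
  eq_zero' x := by rw [pow_eq_zero_iff hd, norm_eq_zero]
  add_le' x y := by
    have h := pow_le_pow_left₀ (norm_nonneg _) (IsUltrametricDist.norm_add_le_max x y) d
    rcases le_total ‖x‖ ‖y‖ with hxy | hxy
    · rw [max_eq_right hxy] at h
      exact h.trans (le_add_of_nonneg_left (pow_nonneg (norm_nonneg x) d))
    · rw [max_eq_left hxy] at h
      exact h.trans (le_add_of_nonneg_right (pow_nonneg (norm_nonneg y) d))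

/-- `modAbs K d x = ‖x‖^d`. [folklore] -/
theorem modAbs_apply (d : ℕ) (hd : d ≠ 0) (x : K) : modAbs K d hd x = ‖x‖ ^ d := rfl

omit [IsUltrametricDist K] in
/-- `λ·𝒪_K` is the closed ball of radius `‖λ‖` (`λ ≠ 0`). [folklore] -/
theorem image_mul_closedBall_one {l : K} (hl : l ≠ 0) :
    (fun x => l * x) '' closedBall (0 : K) 1 = closedBall 0 ‖l‖ := by
  ext y
  simp only [Set.mem_image, mem_closedBall, dist_zero_right]
  constructor
  · rintro ⟨x, hx, rfl⟩
    rw [norm_mul]; exact mul_le_of_le_one_right (norm_nonneg l) hx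
  · intro hy
    refine ⟨l⁻¹ * y, ?_, by rw [← mul_assoc, mul_inv_cancel₀ hl, one_mul]⟩
    rw [norm_mul, norm_inv, inv_mul_le_iff₀ (norm_pos_iff.2 hl), mul_one]
    exact hy

variable [ProperSpace K] [MeasurableSpace K] [BorelSpace K]

/-- **`μ_K(closedBall 0 ‖λ‖) = ‖λ‖^d`** for `λ ≠ 0`, under `‖ϖ‖^d = q⁻¹`: `λ = ϖ^k u`, `μ(m^k) = q^{−k}` ([AbsTopIII] Prop. 5.7
(i)(a), `localVolume_closedBall_zpow`), `‖λ‖^d = (‖ϖ‖^d)^k = q^{−k}`. [folklore] -/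
theorem localVolume_closedBall_norm {ϖ : Kˣ} (hϖ : IsUniformizer ϖ) {d : ℕ}
    (hmod : ‖(ϖ : K)‖ ^ d = ((residueCard K : ℝ))⁻¹) {l : K} (hl : l ≠ 0) :
    localVolume K (closedBall (0 : K) ‖l‖) = ENNReal.ofReal (‖l‖ ^ d) := by
  obtain ⟨k, hk⟩ := hϖ.2 (Units.mk0 l hl)
  rw [Units.val_mk0] at hk
  rw [hk, localVolume_closedBall_zpow K hϖ k, ← ENNReal.ofReal_coe_nnreal]
  congr 1
  push_cast
  rw [← hmod, ← zpow_natCast, ← zpow_natCast, ← zpow_mul, ← zpow_mul, mul_comm]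

/-- **Joshi's §9.10.2 signature at a local field `K`** (every `L′_w`): `Vol_K := μ_K` ([AbsTopIII] Prop. 5.7 (i),
`Literature.IUT.LogVolume.localVolume`), `𝒪_K` = closed unit ball, `|−|_K` = the module `‖−‖^d`; normalisation,
translation invariance, `Vol(λ𝒪) = |λ|` (Lem. 9.10.2.2 (2)) and `|𝒪| ≤ 1` all PROVED, given `‖ϖ‖^d = q⁻¹`. [folklore] -/
def localFieldVolumeDatum {ϖ : Kˣ} (hϖ : IsUniformizer ϖ) {d : ℕ} (hd : d ≠ 0)
    (hmod : ‖(ϖ : K)‖ ^ d = ((residueCard K : ℝ))⁻¹) : VolumeDatum K where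
  vol := localVolume K
  O := unitSubring K
  abs := modAbs K d hd
  vol_O := by rw [coe_unitSubring]; exact localVolume_closedBall_one K
  vol_translate := fun a S => by
    rw [show (fun x => a + x) '' S = a +ᵥ S from Set.image_vadd (a := a) (t := S)]; exact localVolume_vadd K a S
  vol_mulBall := fun l hl => by
    rw [coe_unitSubring, image_mul_closedBall_one K hl]; exact localVolume_closedBall_norm K hϖ hmod hl
  abs_le_one := fun x hx => pow_le_one₀ (norm_nonneg x) hx

variable {K}

/-- **DICTIONARY, PROVED (`rfl`)**: Joshi's `Vol_K` (§9.10.2) at a local field IS Mochizuki's `μ_k` of [AbsTopIII] Prop.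
5.7 (i) as typed in the tree. [folklore] -/
theorem localFieldVolumeDatum_vol {ϖ : Kˣ} (hϖ : IsUniformizer ϖ) {d : ℕ} (hd : d ≠ 0)
    (hmod : ‖(ϖ : K)‖ ^ d = ((residueCard K : ℝ))⁻¹) :
    (localFieldVolumeDatum K hϖ hd hmod).vol = localVolume K := rfl

/-- Joshi's `LogVol_K(α + h𝒪_K) = d · log ‖h‖` (`h ≠ 0`). PROVED. [folklore] -/
theorem logVol_ball_eq_degree_mul_log {ϖ : Kˣ} (hϖ : IsUniformizer ϖ) {d : ℕ} (hd : d ≠ 0)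
    (hmod : ‖(ϖ : K)‖ ^ d = ((residueCard K : ℝ))⁻¹) (α : K) {h : K} (hh : h ≠ 0) :
    (localFieldVolumeDatum K hϖ hd hmod).logVol ((localFieldVolumeDatum K hϖ hd hmod).ball α h)
      = (((d : ℝ) * Real.log ‖h‖ : ℝ) : EReal) := by
  rw [(localFieldVolumeDatum K hϖ hd hmod).logVol_ball α hh]
  change ((Real.log (‖h‖ ^ d) : ℝ) : EReal) = _
  rw [Real.log_pow]

/-- Mochizuki's DEGREE-normalised log-volume ([IUTchIV] Prop. 1.4 (i), `Literature.IUT.LogVolume.normalizedLocalLogVolume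
K d`: «normalized [i.e., by dividing by the degree]») of `h𝒪_K` is `log ‖h‖`. PROVED. [folklore] -/
theorem normalizedLocalLogVolume_closedBall_norm {ϖ : Kˣ} (hϖ : IsUniformizer ϖ) {d : ℕ} (hd : d ≠ 0)
    (hmod : ‖(ϖ : K)‖ ^ d = ((residueCard K : ℝ))⁻¹) {h : K} (hh : h ≠ 0) :
    normalizedLocalLogVolume K d (closedBall (0 : K) ‖h‖) = Real.log ‖h‖ := by
  rw [normalizedLocalLogVolume_eq_div, localLogVolume_eq_log, localVolume_closedBall_norm K hϖ hmod hh,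
    ENNReal.toReal_ofReal (pow_nonneg (norm_nonneg h) d), Real.log_pow]
  have hd' : (d : ℝ) ≠ 0 := by exact_mod_cast hd
  field_simp

/-- **D-05 AT ONE FACTOR, PROVED**: Joshi's log-volume of `h𝒪_K` (§9.10.2, Vol-normalised module) is `[K : ℚ_p]` times
Mochizuki's degree-normalised log-volume of the same set ([IUTchIV] Prop. 1.4 (i)):
`LogVol_K(α + h𝒪_K) = d · μ^log(h𝒪_K)`. Numbers for the «coincides with Rmk 3.1.1» sentence (p.125 l.13–15); no verdict.
[folklore] -/
theorem logVol_ball_eq_degree_mul_normalized {ϖ : Kˣ} (hϖ : IsUniformizer ϖ) {d : ℕ} (hd : d ≠ 0)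
    (hmod : ‖(ϖ : K)‖ ^ d = ((residueCard K : ℝ))⁻¹) (α : K) {h : K} (hh : h ≠ 0) :
    (localFieldVolumeDatum K hϖ hd hmod).logVol ((localFieldVolumeDatum K hϖ hd hmod).ball α h)
      = (((d : ℝ) * normalizedLocalLogVolume K d (closedBall (0 : K) ‖h‖) : ℝ) : EReal) := by
  rw [logVol_ball_eq_degree_mul_log hϖ hd hmod α hh, normalizedLocalLogVolume_closedBall_norm hϖ hd hmod hh]

/-- The weight bookkeeping that goes with it (§9.10.5 (9.10.5.1) + the tower law `d = [K:ℚ_p] = [K:L_{mod,v}]·[L_{mod,v}:ℚ_p]`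
as a hypothesis): Joshi's Γ_p-weighted factor coefficient is `γ · d = [L_{mod,v} : ℚ_p]`. [folklore] -/
theorem gammaP_mul_degree {W : Type*} (deg : W → ℕ+) (w : W) {d dmod : ℕ} (htower : d = (deg w : ℕ) * dmod) :
    gammaP deg w * (d : ℝ) = dmod := by
  unfold gammaP
  rw [htower]
  have : ((deg w : ℕ) : ℝ) ≠ 0 := by exact_mod_cast (deg w).ne_zero
  push_cast
  field_simp

end Summit.ABC.IUTFork.Joshi.LogVol

end
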